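import Summits.RiemannHypothesis.RiemannHypothesis.Theorems.UniversalFactorLaplaceLoopholeInterlacing

/-!
# RiemannHypothesis / UniversalFactor — the close-pair criterion against the loophole

Route `RiemannHypothesis/UniversalFactor`, target `LaplaceLoophole` (stmt-RiemannHypothesis-2575); the
form of the interlacing structure that a SMOOTHED-AWAY CLOSE PAIR of zeta zeros (Lehmer's pair at
`γ ≈ 7005.06, 7005.10` for `a ≲ 37`, item `LehmerPointNoGo` stmt-2582, the upper part `6 ≤ a ≤ 32` of
`MediumKernelNoGo` stmt-2577) violates — again with a purely real-variable certificate.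

Let `a > 0`, `F = F_a = deBruijnHDiv (1 + u²/a²)`, `G = F' + aF`, `H_0 = −(G' − aG)/a²`, and assume
`X(a)`: all zeros of `F` are real. From `UniversalFactorLaplaceLoopholeInterlacing.lean` (`Re(f'/f)`
strictly decreasing on zero-free real intervals, for `f = F` and `f = G`):
(i) between two zeros of `H_0` at which `G ≠ 0` there is a zero of `G`;
(ii) between two distinct zeros of `G` there is a zero of `F`;
(iii) at a zero `x` of `H_0` with `F(x) ≠ 0`, `G(x) ≠ 0`.

* **`UniversalFactor.not_hasOnlyRealZeros_of_pair`.** Let `h₁ < h₂ < h₃` be zeros of `H_0`, `η ≥ 0`,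
  `h₁ + η ≤ h₂`. If `F ≠ 0` on `[h₁ + η, h₃]` (the smoothing has filled the dip between the close pair
  `h₂, h₃` and `F` keeps its sign up to `η` past `h₁`) and `G = F' + aF ≠ 0` on `[h₁, h₁ + η]`, then `F`
  has a non-real zero. Proof: by (i) and (iii) there are zeros `g₁ ∈ [h₁, h₂)`, `g₂ ∈ (h₂, h₃]` of `G`;
  by (ii) a zero `f₀ ∈ [g₁, g₂]` of `F`; as `F ≠ 0` on `[h₁ + η, h₃] ∋ g₂`, `f₀ < h₁ + η`, so
  `g₁ ∈ [h₁, h₁ + η]`, where `G ≠ 0` — contradiction.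
* `UniversalFactor.not_hasOnlyRealZeros_of_pair'` — the mirror image (buffer to the right of `h₃`,
  with `F' − aF ≠ 0` on `[h₃ − η, h₃]`), by evenness of `F` and `H_0`.

Numerically (Lehmer, `a = 16`, `x = 2γ`): `h₁ ≈ 14008.8`, `(h₂, h₃) = (14010.126, 14010.201)`,
`F_16 > 0` on `[h₁ + 0.009, h₃ + 0.1]` while near `h₁` one has `G ≈ F' (1 + 16(x − f)) ≠ 0` on
`[h₁, h₁ + 0.009]` (`f ≈ h₁ + 0.008` the zero of `F_16` next to `h₁`): a certificate in interval
arithmetic of two one-signedness statements plus three signs of Hardy's `Z`.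
-/

noncomputable section

namespace Summit.RiemannHypothesis.RiemannHypothesis.Theorems

open MeasureTheory Set Filter Complex
open scoped Topology
open Literature.NumberTheory.LFunctions Literature.Analysis.Complex
open Summit.RiemannHypothesis.RiemannHypothesis.Theses

/-- **The close-pair criterion.** `a > 0`; `h₁ < h₂ < h₃` zeros of `H_0`; `0 ≤ η`, `h₁ + η ≤ h₂`;
`F_a ≠ 0` on `[h₁ + η, h₃]`; `F_a' + aF_a ≠ 0` on `[h₁, h₁ + η]`. Then `F_a = deBruijnHDiv (1 + u²/a²)`
has a non-real zero. [folklore] -/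
theorem UniversalFactor.not_hasOnlyRealZeros_of_pair {a : ℝ} (ha : 0 < a) {h₁ h₂ h₃ η : ℝ}
    (h12 : h₁ < h₂) (h23 : h₂ < h₃) (hη : 0 ≤ η) (hηh : h₁ + η ≤ h₂)
    (hz₁ : deBruijnH 0 h₁ = 0) (hz₂ : deBruijnH 0 h₂ = 0) (hz₃ : deBruijnH 0 h₃ = 0)
    (hF : ∀ x ∈ Icc (h₁ + η) h₃, deBruijnHDiv (fun u : ℝ => 1 + u ^ 2 / a ^ 2) x ≠ 0)
    (hG : ∀ x ∈ Icc h₁ (h₁ + η), deriv (deBruijnHDiv fun u : ℝ => 1 + u ^ 2 / a ^ 2) x +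
      (a : ℂ) * deBruijnHDiv (fun u : ℝ => 1 + u ^ 2 / a ^ 2) x ≠ 0) :
    ¬ HasOnlyRealZeros (deBruijnHDiv fun u : ℝ => 1 + u ^ 2 / a ^ 2) := by
  intro hX
  set F : ℂ → ℂ := deBruijnHDiv fun u : ℝ => 1 + u ^ 2 / a ^ 2 with hFdef
  have hFd : Differentiable ℂ F := differentiable_deBruijnHDiv_laplace a
  have hFreal : ∀ x : ℝ, (F x).im = 0 := fun x => deBruijnHDiv_ofReal_im _ x
  obtain ⟨ρ, C, hρ0, hρ, hgr⟩ := UniversalFactor.exists_growth_deBruijnHDiv_laplace a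
  have hzero : ∀ z, F z = 0 → z.im = 0 := hX
  have ha0 : (a : ℂ) ≠ 0 := by exact_mod_cast ha.ne'
  have hH0ne : deBruijnH 0 0 ≠ 0 := deBruijnH_apply_zero_ne_zero 0
  have hF₂ : F h₂ ≠ 0 := hF h₂ ⟨hηh, h23.le⟩
  have hF₃ : F h₃ ≠ 0 := hF h₃ ⟨hηh.trans h23.le, le_rfl⟩
  -- the ODE and `G = F' + aF`
  have hODE : ∀ z, F z - deriv (deriv F) z / (a : ℂ) ^ 2 = deBruijnH 0 z := fun z =>
    deBruijnHDiv_laplace_sub_deriv_deriv a z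
  have hFd' : Differentiable ℂ (deriv F) := hFd.deriv
  set G : ℂ → ℂ := fun z => deriv F z + (a : ℂ) * F z with hGdef
  have hG₁ : G h₁ ≠ 0 := hG h₁ ⟨le_rfl, by linarith⟩
  have hGd : Differentiable ℂ G := hFd'.add (hFd.const_mul _)
  have hderivG : ∀ z, deriv G z = deriv (deriv F) z + (a : ℂ) * deriv F z := fun z => by
    have h := ((hFd' z).hasDerivAt).add (((hFd z).hasDerivAt).const_mul (a : ℂ))
    exact h.deriv
  have hH : ∀ z, deBruijnH 0 z = -(deriv G z - (a : ℂ) * G z) / (a : ℂ) ^ 2 := by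
    intro z
    rw [← hODE z, hderivG]
    simp only [hGdef]
    field_simp
    ring
  have hGreal : ∀ x : ℝ, (G x).im = 0 := fun x => by
    simp only [hGdef, Complex.add_im, Complex.mul_im, Complex.ofReal_re, Complex.ofReal_im,
      zero_mul, add_zero, im_deriv_ofReal hFd hFreal x, hFreal x, mul_zero]
  have hzeroH : ∀ x : ℝ, deBruijnH 0 x = 0 → deriv G x = (a : ℂ) * G x := by
    intro x hx
    have h := hH x
    rw [hx] at h
    have h' := (div_eq_zero_iff.1 h.symm).resolve_right (pow_ne_zero 2 ha0)
    rw [neg_eq_zero, sub_eq_zero] at h'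
    exact h'
  -- Step 0: `F` has a zero
  have hexF : ∃ a₀, F a₀ = 0 := by
    by_contra hnone
    push Not at hnone
    set g : ℂ → ℂ := fun z => deriv F z / F z with hg
    have hgd : Differentiable ℂ g := fun z => ((hFd' z).div (hFd z) (hnone z))
    have hgim : ∀ z, (g z).im = 0 := fun z =>
      im_logDeriv_eq_zero_of_forall_ne_zero hFd hρ0 hρ hgr hFreal hnone z
    have hgc : ∀ z, g z = g 0 := fun z => UniversalFactor.apply_eq_apply_of_im_eq_zero hgd hgim z 0
    set c : ℂ := g 0 with hc
    have hF' : ∀ z, deriv F z = c * F z := fun z => by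
      have := hgc z
      simp only [hg] at this
      rw [← this, div_mul_cancel₀ _ (hnone z)]
    have hF'' : ∀ z, deriv (deriv F) z = c * (c * F z) := fun z => by
      have hfun : deriv F = fun z => c * F z := funext hF'
      rw [hfun, deriv_const_mul _ (hFd z), hF']
    have hHc : ∀ z, deBruijnH 0 z = (1 - c ^ 2 / (a : ℂ) ^ 2) * F z := fun z => by
      rw [← hODE z, hF'' z]; ring
    have hx := hHc h₂
    rw [hz₂] at hx
    rcases mul_eq_zero.1 hx.symm with h | h
    · apply hH0ne
      rw [hHc, h, zero_mul]
    · exact hF₂ h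
  obtain ⟨a₀, ha₀⟩ := hexF
  -- Step 1: where `G = 0` and `F ≠ 0`, `F'/F = −a`
  have hGzeroF : ∀ x : ℝ, F x ≠ 0 → G x = 0 → (deriv F x / F x).re = -a := by
    intro x hFx hGx
    have : deriv F x = -(a : ℂ) * F x := by
      have h0 : deriv F x + (a : ℂ) * F x = 0 := hGx
      linear_combination h0
    rw [this, mul_div_assoc, div_self hFx, mul_one]
    simp
  -- Step 2: at a zero of `H_0` with `F ≠ 0`, `G ≠ 0`
  have hGne : ∀ x : ℝ, F x ≠ 0 → deBruijnH 0 x = 0 → G x ≠ 0 := by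
    intro x hFx hHx hGx
    have hG'0 : deriv G x = 0 := by rw [hzeroH x hHx, hGx, mul_zero]
    have hF'x : deriv F x = -(a : ℂ) * F x := by
      have h0 : deriv F x + (a : ℂ) * F x = 0 := hGx
      linear_combination h0
    have hq : deriv (fun z => deriv F z / F z) x =
        (deriv (deriv F) x * F x - deriv F x * deriv F x) / (F x) ^ 2 :=
      deriv_div (hFd' x) (hFd x) hFx
    have hG'x : deriv G x = deriv (deriv F) x - (a : ℂ) ^ 2 * F x := by
      rw [hderivG, hF'x]; ring
    have hq0 : deriv (fun z => deriv F z / F z) x = 0 := by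
      rw [hq, hF'x]
      have : deriv (deriv F) x * F x - -(a : ℂ) * F x * (-(a : ℂ) * F x) =
          (deriv (deriv F) x - (a : ℂ) ^ 2 * F x) * F x := by ring
      rw [this, ← hG'x, hG'0, zero_mul, zero_div]
    have hlt := UniversalFactor.re_deriv_logDeriv_le hFd hρ0 hρ hgr hFreal hzero ha₀ hFx
    rw [hq0, Complex.zero_re] at hlt
    have hxa : (x : ℂ) - a₀ ≠ 0 := by
      intro h0; rw [sub_eq_zero] at h0; rw [h0] at hFx; exact hFx ha₀
    have hpos : 0 < 1 / ‖(x : ℂ) - a₀‖ ^ 2 := by positivity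
    linarith
  have hG₂ : G h₂ ≠ 0 := hGne h₂ hF₂ hz₂
  have hG₃ : G h₃ ≠ 0 := hGne h₃ hF₃ hz₃
  -- Step 3: `G` real entire of order `< 2`, only real zeros, with a zero
  obtain ⟨ρ', C', hρ'0, hρ', hgr'⟩ := UniversalFactor.exists_growth_deriv_add_mul hFd hρ0 hρ hgr (a : ℂ)
  have hGzero : ∀ z, G z = 0 → z.im = 0 := by
    rcases UniversalFactor.laguerre_step hFd hρ0 hρ hgr hFreal hzero a with hG0 | hGz
    · exact absurd (hG0 h₂) hG₂
    · exact hGz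
  have hψG : ∀ x : ℝ, G x ≠ 0 → deBruijnH 0 x = 0 → (deriv G x / G x).re = a := by
    intro x hGx hHx
    rw [hzeroH x hHx, mul_div_assoc, div_self hGx, mul_one]
    simp
  have hexG : ∃ b₀, G b₀ = 0 := by
    by_contra hnone
    push Not at hnone
    set g : ℂ → ℂ := fun z => deriv G z / G z with hg
    have hgd : Differentiable ℂ g := fun z => ((hGd.deriv z).div (hGd z) (hnone z))
    have hgim : ∀ z, (g z).im = 0 := fun z =>
      im_logDeriv_eq_zero_of_forall_ne_zero hGd hρ'0 hρ' hgr' hGreal hnone z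
    have hgc : ∀ z, g z = g h₂ := fun z =>
      UniversalFactor.apply_eq_apply_of_im_eq_zero hgd hgim z h₂
    have hgh₂ : g h₂ = a := by
      simp only [hg]
      rw [hzeroH h₂ hz₂, mul_div_assoc, div_self (hnone _), mul_one]
    have hG' : ∀ z, deriv G z = (a : ℂ) * G z := fun z => by
      have := hgc z
      rw [hgh₂] at this
      simp only [hg] at this
      rw [← this, div_mul_cancel₀ _ (hnone z)]
    apply hH0ne
    rw [hH, hG', sub_self, neg_zero, zero_div]
  obtain ⟨b₀, hb₀⟩ := hexG
  -- (i) a zero of `G` between two zeros of `H_0` at which `G ≠ 0`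
  have hGbetween : ∀ y₁ y₂ : ℝ, y₁ < y₂ → deBruijnH 0 y₁ = 0 → deBruijnH 0 y₂ = 0 →
      G y₁ ≠ 0 → G y₂ ≠ 0 → ∃ g ∈ Icc y₁ y₂, G g = 0 := by
    intro y₁ y₂ hlt hH₁ hH₂ hG1 hG2
    by_contra hnone
    push Not at hnone
    have heq := UniversalFactor.eq_of_re_logDeriv_eq hGd hρ'0 hρ' hgr' hGreal hGzero hb₀ hnone
      (left_mem_Icc.2 hlt.le) (right_mem_Icc.2 hlt.le)
      ((hψG y₁ hG1 hH₁).trans (hψG y₂ hG2 hH₂).symm)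
    exact hlt.ne heq
  -- (ii) a zero of `F` between two distinct zeros of `G`
  have hFbetween : ∀ y₁ y₂ : ℝ, y₁ < y₂ → G y₁ = 0 → G y₂ = 0 → ∃ f₀ ∈ Icc y₁ y₂, F f₀ = 0 := by
    intro y₁ y₂ hlt hG1 hG2
    by_contra hnone
    push Not at hnone
    have heq := UniversalFactor.eq_of_re_logDeriv_eq hFd hρ0 hρ hgr hFreal hzero ha₀ hnone
      (left_mem_Icc.2 hlt.le) (right_mem_Icc.2 hlt.le)
      ((hGzeroF y₁ (hnone y₁ (left_mem_Icc.2 hlt.le)) hG1).trans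
        (hGzeroF y₂ (hnone y₂ (right_mem_Icc.2 hlt.le)) hG2).symm)
    exact hlt.ne heq
  -- the zeros `g₁ ∈ [h₁, h₂)`, `g₂ ∈ (h₂, h₃]`, `f₀ ∈ [g₁, g₂]`
  obtain ⟨g₂, hg₂I, hGg₂⟩ := hGbetween h₂ h₃ h23 hz₂ hz₃ hG₂ hG₃
  obtain ⟨g₁, hg₁I, hGg₁⟩ := hGbetween h₁ h₂ h12 hz₁ hz₂ hG₁ hG₂
  have hg₁lt : g₁ < h₂ := lt_of_le_of_ne hg₁I.2 fun h => hG₂ (h ▸ hGg₁)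
  have hg₂gt : h₂ < g₂ := lt_of_le_of_ne hg₂I.1 fun h => hG₂ (h.symm ▸ hGg₂)
  obtain ⟨f₀, hf₀I, hFf₀⟩ := hFbetween g₁ g₂ (hg₁lt.trans hg₂gt) hGg₁ hGg₂
  -- `f₀ < h₁ + η` since `F ≠ 0` on `[h₁ + η, h₃] ∋ f₀` otherwise
  have hf₀lt : f₀ < h₁ + η := by
    by_contra h
    push Not at h
    exact hF f₀ ⟨h, hf₀I.2.trans hg₂I.2⟩ hFf₀
  -- hence `g₁ ∈ [h₁, h₁ + η]`, where `G ≠ 0`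
  exact hG g₁ ⟨hg₁I.1, by linarith [hf₀I.1]⟩ hGg₁

/-- `F_a` is even, so its derivative is odd: `F_a'(−z) = −F_a'(z)`. [folklore] -/
theorem UniversalFactor.deriv_deBruijnHDiv_neg (m : ℝ → ℝ) (z : ℂ) :
    deriv (deBruijnHDiv m) (-z) = -deriv (deBruijnHDiv m) z := by
  have heven : (deBruijnHDiv m) = fun w => deBruijnHDiv m (-w) := funext fun w => (deBruijnHDiv_neg m w).symm
  have h1 : deriv (fun w => deBruijnHDiv m (-w)) z = -deriv (deBruijnHDiv m) (-z) := by
    rw [deriv_comp_neg (deBruijnHDiv m) z]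
  rw [← heven] at h1
  rw [h1, neg_neg]

/-- **The close-pair criterion, mirrored** (buffer on the right): `a > 0`; `h₁ < h₂ < h₃` zeros of
`H_0`; `0 ≤ η`, `h₂ ≤ h₃ − η`; `F_a ≠ 0` on `[h₁, h₃ − η]`; `F_a' − aF_a ≠ 0` on `[h₃ − η, h₃]`. Then
`F_a` has a non-real zero. (Apply `not_hasOnlyRealZeros_of_pair` to the zeros `−h₃ < −h₂ < −h₁`: `H_0`
and `F_a` are even, `F_a'` is odd.) [folklore] -/
theorem UniversalFactor.not_hasOnlyRealZeros_of_pair' {a : ℝ} (ha : 0 < a) {h₁ h₂ h₃ η : ℝ}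
    (h12 : h₁ < h₂) (h23 : h₂ < h₃) (hη : 0 ≤ η) (hηh : h₂ ≤ h₃ - η)
    (hz₁ : deBruijnH 0 h₁ = 0) (hz₂ : deBruijnH 0 h₂ = 0) (hz₃ : deBruijnH 0 h₃ = 0)
    (hF : ∀ x ∈ Icc h₁ (h₃ - η), deBruijnHDiv (fun u : ℝ => 1 + u ^ 2 / a ^ 2) x ≠ 0)
    (hG : ∀ x ∈ Icc (h₃ - η) h₃, deriv (deBruijnHDiv fun u : ℝ => 1 + u ^ 2 / a ^ 2) x -
      (a : ℂ) * deBruijnHDiv (fun u : ℝ => 1 + u ^ 2 / a ^ 2) x ≠ 0) :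
    ¬ HasOnlyRealZeros (deBruijnHDiv fun u : ℝ => 1 + u ^ 2 / a ^ 2) := by
  set m : ℝ → ℝ := fun u : ℝ => 1 + u ^ 2 / a ^ 2 with hm
  have hHneg : ∀ x : ℝ, deBruijnH 0 ((-x : ℝ) : ℂ) = deBruijnH 0 x := fun x => by
    rw [Complex.ofReal_neg, deBruijnH_neg]
  have hFneg : ∀ x : ℝ, deBruijnHDiv m ((-x : ℝ) : ℂ) = deBruijnHDiv m x := fun x => by
    rw [Complex.ofReal_neg, deBruijnHDiv_neg]
  refine UniversalFactor.not_hasOnlyRealZeros_of_pair (h₁ := -h₃) (h₂ := -h₂) (h₃ := -h₁) (η := η)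
    ha (by linarith) (by linarith) hη (by linarith) ?_ ?_ ?_ ?_ ?_
  · rw [hHneg]; exact hz₃
  · rw [hHneg]; exact hz₂
  · rw [hHneg]; exact hz₁
  · intro x hx
    rw [show (x : ℂ) = (((-(-x) : ℝ)) : ℂ) by push_cast; ring, hFneg]
    exact hF (-x) ⟨by linarith [hx.2], by linarith [hx.1]⟩
  · intro x hx
    have hx' : -x ∈ Icc (h₃ - η) h₃ := ⟨by linarith [hx.2], by linarith [hx.1]⟩
    have h := hG (-x) hx'
    have e1 : deBruijnHDiv m (x : ℂ) = deBruijnHDiv m (((-x : ℝ)) : ℂ) := (hFneg x).symm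
    have e2 : deriv (deBruijnHDiv m) (x : ℂ) = -deriv (deBruijnHDiv m) (((-x : ℝ)) : ℂ) := by
      rw [Complex.ofReal_neg, UniversalFactor.deriv_deBruijnHDiv_neg m, neg_neg]
    rw [e1, e2]
    intro h0
    apply h
    linear_combination -h0


/-- **The close-pair criterion from sign data** (the certifiable form). `a > 0`, `0 ≤ η`; points
`u₁ ≤ v₁`, `u₂ ≤ v₂`, `u₃ ≤ v₃` with `v₁ + η ≤ u₂`, `v₂ ≤ u₃`, at which `Re H_0` changes sign on each of
`[u₁, v₁]`, `[u₂, v₂]`, `[u₃, v₃]` (so `H_0` has zeros `h₁ < h₂ < h₃` there, by the IVT); `F_a ≠ 0` on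
`[u₁ + η, v₃]`; `F_a' + aF_a ≠ 0` on `[u₁, v₁ + η]`. Then `F_a` has a non-real zero. (Everything here is
decided by interval arithmetic: six signs of Hardy's `Z` and two one-signedness statements.) [folklore] -/
theorem UniversalFactor.not_hasOnlyRealZeros_of_pair_signs {a : ℝ} (ha : 0 < a) {η u₁ v₁ u₂ v₂ u₃ v₃ : ℝ}
    (hη : 0 ≤ η) (huv₁ : u₁ ≤ v₁) (huv₂ : u₂ ≤ v₂) (huv₃ : u₃ ≤ v₃) (h12 : v₁ + η ≤ u₂) (h23 : v₂ ≤ u₃)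
    (hs₁ : (deBruijnH 0 u₁).re * (deBruijnH 0 v₁).re < 0)
    (hs₂ : (deBruijnH 0 u₂).re * (deBruijnH 0 v₂).re < 0)
    (hs₃ : (deBruijnH 0 u₃).re * (deBruijnH 0 v₃).re < 0)
    (hF : ∀ x ∈ Icc (u₁ + η) v₃, deBruijnHDiv (fun u : ℝ => 1 + u ^ 2 / a ^ 2) x ≠ 0)
    (hG : ∀ x ∈ Icc u₁ (v₁ + η), deriv (deBruijnHDiv fun u : ℝ => 1 + u ^ 2 / a ^ 2) x +
      (a : ℂ) * deBruijnHDiv (fun u : ℝ => 1 + u ^ 2 / a ^ 2) x ≠ 0) :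
    ¬ HasOnlyRealZeros (deBruijnHDiv fun u : ℝ => 1 + u ^ 2 / a ^ 2) := by
  -- zeros of `H_0` from the sign changes (IVT on the continuous real function `x ↦ Re H_0(x)`)
  have hcont : Continuous fun x : ℝ => (deBruijnH 0 x).re :=
    Complex.continuous_re.comp ((differentiable_deBruijnH_holds 0).continuous.comp Complex.continuous_ofReal)
  have him : ∀ x : ℝ, (deBruijnH 0 x).im = 0 := fun x => by
    rw [← deBruijnHDiv_one']; exact deBruijnHDiv_ofReal_im _ x
  have hzero : ∀ {u v : ℝ}, u ≤ v → (deBruijnH 0 u).re * (deBruijnH 0 v).re < 0 →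
      ∃ x ∈ Icc u v, deBruijnH 0 x = 0 := by
    intro u v huv hs
    obtain ⟨x, hxI, hx0⟩ : ∃ x ∈ Icc u v, (deBruijnH 0 x).re = 0 := by
      rcases mul_neg_iff.1 hs with ⟨hu, hv⟩ | ⟨hu, hv⟩
      · exact intermediate_value_Icc' huv hcont.continuousOn ⟨hv.le, hu.le⟩
      · exact intermediate_value_Icc huv hcont.continuousOn ⟨hu.le, hv.le⟩
    exact ⟨x, hxI, Complex.ext (by simpa using hx0) (by simpa using him x)⟩
  obtain ⟨h₁, hh₁, hz₁⟩ := hzero huv₁ hs₁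
  obtain ⟨h₂, hh₂, hz₂⟩ := hzero huv₂ hs₂
  obtain ⟨h₃, hh₃, hz₃⟩ := hzero huv₃ hs₃
  -- strict ordering: a zero cannot sit at an endpoint where `Re H_0 ≠ 0`
  have hre0 : ∀ x : ℝ, deBruijnH 0 x = 0 → (deBruijnH 0 x).re = 0 := fun x hx => by rw [hx]; simp
  have hv₁ : (deBruijnH 0 v₁).re ≠ 0 := fun h => by rw [h, mul_zero] at hs₁; exact lt_irrefl _ hs₁
  have hv₂ : (deBruijnH 0 v₂).re ≠ 0 := fun h => by rw [h, mul_zero] at hs₂; exact lt_irrefl _ hs₂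
  have h1v : h₁ < v₁ := lt_of_le_of_ne hh₁.2 fun h => hv₁ (h ▸ hre0 h₁ hz₁)
  have h2v : h₂ < v₂ := lt_of_le_of_ne hh₂.2 fun h => hv₂ (h ▸ hre0 h₂ hz₂)
  have hlt12 : h₁ < h₂ := by linarith [hh₂.1]
  have hlt23 : h₂ < h₃ := by linarith [hh₃.1]
  exact UniversalFactor.not_hasOnlyRealZeros_of_pair (h₁ := h₁) (h₂ := h₂) (h₃ := h₃) (η := η) ha
    hlt12 hlt23 hη (by linarith [hh₁.2, hh₂.1]) hz₁ hz₂ hz₃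
    (fun x hx => hF x ⟨by linarith [hx.1, hh₁.1], hx.2.trans hh₃.2⟩)
    (fun x hx => hG x ⟨hh₁.1.trans hx.1, by linarith [hx.2, hh₁.2]⟩)

end Summit.RiemannHypothesis.RiemannHypothesis.Theorems
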